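import Summits.HubbardSuperconductivity.HubbardSuperconductivity.Theorems.AnisotropyChordPerronBranchSmooth

/-!
# Route `AnisotropyChord`, crux `ChordXY` (stmt-HubbardSuperconductivity-8146), line `doob-johnson-chord`,
# PLAN A / H1 infrastructure, part 2: identities along a differentiable eigenpair branch —
# Hellmann–Feynman, the first-order perturbation equation, and the derivative of a quadratic form
# (general matrix analysis; support file, lead-8146-chordxy g1)

Namespace `…Theorems.AnisotropyChord.PerronBranch` (continued from `…PerronBranchSmooth`).  For an
entrywise differentiable family `T` of real matrices (`T θ` symmetric) and a differentiable unit eigenpair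
branch `T t N t = Λ t N t`:
* `hasDerivAt_dotProduct_mulVec` — product rule for `θ ↦ ⟨a θ, M θ b θ⟩`;
* `deriv_eigenvector_orthogonal` — `⟨N', N θ⟩ = 0`;
* `hasDerivAt_eigenvalue_eq_hellmannFeynman` — `Λ' = ⟨N θ, T' N θ⟩` (Kato II-§5.4 Thm 5.4, `m = 1`);
* `firstOrder_eigenvector_equation` — `(T θ - Λ θ) N' = Λ' N θ - T' N θ` (Kato II-(2.14));
* `hasDerivAt_quadraticForm_of_isSymm` — for a fixed symmetric `O`, `d/dθ ⟨N, O N⟩ = 2⟨N', O N θ⟩`,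
  and its Doob form `two_mul_dotProduct_mulVec_eq_sum_field` (`= Σ_i g(i) ∂(N(i)²)`, `g = (O N)/N`).
Theorems only; no definition; no `sorry`.  HONEST: textbook calculus; nothing here is specific to the
XXZ model, proves `ChordXY`, or advances superconductivity in the Hubbard model.

## References
* T. Kato, *Perturbation Theory for Linear Operators*, Springer 1966, Ch. II §2.2 (2.14), §5.4
  Thm 5.4 (5.10). [Kato1966]
-/

set_option linter.dupNamespace false

noncomputable section

namespace Summit.HubbardSuperconductivity.HubbardSuperconductivity.Theorems.AnisotropyChord.PerronBranch

open _root_.Matrix Filter Topology Set Function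

variable {ι : Type*} [Fintype ι]

/-! ### Identities along a differentiable unit eigenpair branch -/

section Identities

variable {T : ℝ → Matrix ι ι ℝ} {T' : Matrix ι ι ℝ} {N : ℝ → ι → ℝ} {N' : ι → ℝ}
  {Λ : ℝ → ℝ} {Λ' θ : ℝ}

/-- Derivative of a bilinear pairing `θ ↦ ⟨a θ, M θ b θ⟩` from the derivatives of its three
arguments (finite sums). [folklore] -/
theorem hasDerivAt_dotProduct_mulVec {a b : ℝ → ι → ℝ} {a' b' : ι → ℝ} {M : ℝ → Matrix ι ι ℝ}
    {M' : Matrix ι ι ℝ} {θ : ℝ} (ha : HasDerivAt a a' θ) (hb : HasDerivAt b b' θ)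
    (hM : ∀ i j, HasDerivAt (fun t => M t i j) (M' i j) θ) :
    HasDerivAt (fun t => a t ⬝ᵥ M t *ᵥ b t)
      (a' ⬝ᵥ M θ *ᵥ b θ + a θ ⬝ᵥ M' *ᵥ b θ + a θ ⬝ᵥ M θ *ᵥ b') θ := by
  have ha' : ∀ i, HasDerivAt (fun t => a t i) (a' i) θ := hasDerivAt_pi.1 ha
  have hb' : ∀ j, HasDerivAt (fun t => b t j) (b' j) θ := hasDerivAt_pi.1 hb
  have h : (fun t => a t ⬝ᵥ M t *ᵥ b t) = fun t => ∑ i, ∑ j, a t i * (M t i j * b t j) := by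
    funext t
    simp only [dotProduct, mulVec, Finset.mul_sum]
  rw [h]
  have hterm : ∀ i j, HasDerivAt (fun t => a t i * (M t i j * b t j))
      (a' i * (M θ i j * b θ j) + a θ i * (M' i j * b θ j + M θ i j * b' j)) θ := by
    intro i j
    exact (ha' i).mul ((hM i j).mul (hb' j))
  have hsum : HasDerivAt (fun t => ∑ i, ∑ j, a t i * (M t i j * b t j))
      (∑ i, ∑ j, (a' i * (M θ i j * b θ j) + a θ i * (M' i j * b θ j + M θ i j * b' j))) θ :=
    HasDerivAt.fun_sum fun i _ => HasDerivAt.fun_sum fun j _ => hterm i j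
  refine hsum.congr_deriv ?_
  have e : a' ⬝ᵥ M θ *ᵥ b θ + a θ ⬝ᵥ M' *ᵥ b θ + a θ ⬝ᵥ M θ *ᵥ b' =
      ∑ i, ∑ j, (a' i * (M θ i j * b θ j) + a θ i * (M' i j * b θ j + M θ i j * b' j)) := by
    simp only [dotProduct, mulVec, Finset.mul_sum, ← Finset.sum_add_distrib]
    refine Finset.sum_congr rfl fun i _ => Finset.sum_congr rfl fun j _ => ?_
    ring
  exact e.symm

/-- **Along a differentiable unit-vector branch the derivative is orthogonal**: `⟨N θ, N θ⟩ = 1`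
for all `θ` and `N` differentiable at `θ` give `⟨N', N θ⟩ = 0`. [folklore] -/
theorem deriv_eigenvector_orthogonal (hN : HasDerivAt N N' θ) (hunit : ∀ t, N t ⬝ᵥ N t = 1) :
    N' ⬝ᵥ N θ = 0 := by
  have hN' : ∀ i, HasDerivAt (fun t => N t i) (N' i) θ := hasDerivAt_pi.1 hN
  have h : HasDerivAt (fun t => N t ⬝ᵥ N t) (∑ i, (N' i * N θ i + N θ i * N' i)) θ := by
    have : (fun t => N t ⬝ᵥ N t) = fun t => ∑ i, N t i * N t i := by
      funext t; rfl
    rw [this]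
    exact HasDerivAt.fun_sum fun i _ => (hN' i).mul (hN' i)
  have hc : HasDerivAt (fun t => N t ⬝ᵥ N t) 0 θ := by
    have : (fun t => N t ⬝ᵥ N t) = fun _ => (1 : ℝ) := funext hunit
    rw [this]
    exact hasDerivAt_const θ 1
  have heq := h.unique hc
  rw [Finset.sum_add_distrib] at heq
  have h2 : ∑ i, N θ i * N' i = ∑ i, N' i * N θ i :=
    Finset.sum_congr rfl fun i _ => mul_comm _ _
  rw [h2, ← two_mul] at heq
  rw [dotProduct]
  linarith

/-- **Hellmann–Feynman along a differentiable eigenpair branch.**  If `T` is entrywise differentiable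
at `θ` with derivative `T'`, `T θ` is symmetric, `N`, `Λ` are differentiable at `θ`, `‖N t‖ = 1` and
`T t N t = Λ t N t` for all `t`, then `Λ' = ⟨N θ, T' N θ⟩`.
[cite: Kato1966, II-§5.4 Thm 5.4 (5.10) with `m = 1`] -/
theorem hasDerivAt_eigenvalue_eq_hellmannFeynman
    (hT : ∀ i j, HasDerivAt (fun t => T t i j) (T' i j) θ) (hsymm : (T θ).IsSymm)
    (hN : HasDerivAt N N' θ) (hΛ : HasDerivAt Λ Λ' θ)
    (hunit : ∀ t, N t ⬝ᵥ N t = 1) (heig : ∀ t, T t *ᵥ N t = Λ t • N t) :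
    Λ' = N θ ⬝ᵥ T' *ᵥ N θ := by
  have horth : N' ⬝ᵥ N θ = 0 := deriv_eigenvector_orthogonal hN hunit
  -- `⟨N, T N⟩ = Λ`, differentiate both sides
  have h := hasDerivAt_dotProduct_mulVec hN hN hT
  have hΛ' : HasDerivAt (fun t => N t ⬝ᵥ T t *ᵥ N t) Λ' θ := by
    have : (fun t => N t ⬝ᵥ T t *ᵥ N t) = Λ := by
      funext t
      rw [heig t, dotProduct_smul, hunit t, smul_eq_mul, mul_one]
    rw [this]
    exact hΛ
  have heq := h.unique hΛ'
  -- `⟨N', T N⟩ = Λ ⟨N', N⟩ = 0` and `⟨N, T N'⟩ = ⟨T N, N'⟩ = 0`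
  have h1 : N' ⬝ᵥ T θ *ᵥ N θ = 0 := by
    rw [heig θ, dotProduct_smul, horth, smul_eq_mul, mul_zero]
  have h2 : N θ ⬝ᵥ T θ *ᵥ N' = 0 := by
    rw [dotProduct_mulVec_comm_of_isSymm hsymm, h1]
  rw [h1, h2, zero_add, add_zero] at heq
  exact heq.symm

/-- **The first-order perturbation equation** along a differentiable eigenpair branch:
`(T θ - Λ θ) N' = Λ' N θ - T' N θ` (componentwise derivative of `T t N t = Λ t N t`).  Together
with `⟨N', N θ⟩ = 0` (`deriv_eigenvector_orthogonal`) and the gap this determines `N'`.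
[cite: Kato1966, II-§2.2 (2.14) and II-§5.4 (first-order coefficients)] -/
theorem firstOrder_eigenvector_equation
    (hT : ∀ i j, HasDerivAt (fun t => T t i j) (T' i j) θ)
    (hN : HasDerivAt N N' θ) (hΛ : HasDerivAt Λ Λ' θ) (heig : ∀ t, T t *ᵥ N t = Λ t • N t) :
    T θ *ᵥ N' - Λ θ • N' = Λ' • N θ - T' *ᵥ N θ := by
  have hN' : ∀ j, HasDerivAt (fun t => N t j) (N' j) θ := hasDerivAt_pi.1 hN
  funext i
  -- derivative of `t ↦ (T t N t) i = Σ_j T t i j * N t j`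
  have hL : HasDerivAt (fun t => (T t *ᵥ N t) i) (∑ j, (T' i j * N θ j + T θ i j * N' j)) θ := by
    have : (fun t => (T t *ᵥ N t) i) = fun t => ∑ j, T t i j * N t j := by
      funext t; simp [mulVec, dotProduct]
    rw [this]
    exact HasDerivAt.fun_sum fun j _ => (hT i j).mul (hN' j)
  -- derivative of `t ↦ (Λ t • N t) i = Λ t * N t i`
  have hR : HasDerivAt (fun t => (Λ t • N t) i) (Λ' * N θ i + Λ θ * N' i) θ := by
    have : (fun t => (Λ t • N t) i) = fun t => Λ t * N t i := by
      funext t; simp [Pi.smul_apply, smul_eq_mul]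
    rw [this]
    exact hΛ.mul (hN' i)
  have hfun : (fun t => (T t *ᵥ N t) i) = fun t => (Λ t • N t) i := by
    funext t; rw [heig t]
  rw [hfun] at hL
  have heq := hL.unique hR
  simp only [Pi.sub_apply, Pi.smul_apply, smul_eq_mul, mulVec, dotProduct]
  rw [Finset.sum_add_distrib] at heq
  have hsplit : ∑ j, T' i j * N θ j + ∑ j, T θ i j * N' j = Λ' * N θ i + Λ θ * N' i := heq
  linarith

/-- **Derivative of a quadratic form along a differentiable branch**: for a FIXED symmetric `O`,
`d/dθ ⟨N θ, O N θ⟩ = 2 ⟨N', O N θ⟩`. (With `N` the Perron branch and `O` an observable this is the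
derivative whose Doob form is `Σ_σ g(σ) ∂_θ N(σ)²`, `g = (O N)/N`.) [folklore] -/
theorem hasDerivAt_quadraticForm_of_isSymm {O : Matrix ι ι ℝ} (hO : O.IsSymm)
    (hN : HasDerivAt N N' θ) :
    HasDerivAt (fun t => N t ⬝ᵥ O *ᵥ N t) (2 * (N' ⬝ᵥ O *ᵥ N θ)) θ := by
  have hM : ∀ i j, HasDerivAt (fun _ : ℝ => O i j) ((0 : Matrix ι ι ℝ) i j) θ :=
    fun i j => by simpa using hasDerivAt_const θ (O i j)
  have h := hasDerivAt_dotProduct_mulVec (M := fun _ => O) hN hN hM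
  simp only [zero_mulVec, dotProduct_zero, add_zero] at h
  have hsym : N θ ⬝ᵥ O *ᵥ N' = N' ⬝ᵥ O *ᵥ N θ := dotProduct_mulVec_comm_of_isSymm hO _ _
  rw [hsym, ← two_mul] at h
  exact h

/-- **Doob form of the quadratic-form derivative**: for `N θ` with non-zero entries,
`2⟨N', O N θ⟩ = Σ_i g(i) · (2 N θ i · N' i)` with the local field `g(i) = (O N θ) i / N θ i` — the
derivative of `⟨N, O N⟩ = Σ_i N(i)² g(i)` with the field frozen (`Σ_i N(i)² ∂g(i) = 0` by symmetry of
`O`). [folklore] -/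
theorem two_mul_dotProduct_mulVec_eq_sum_field {O : Matrix ι ι ℝ} (hpos : ∀ i, N θ i ≠ 0) :
    2 * (N' ⬝ᵥ O *ᵥ N θ) = ∑ i, ((O *ᵥ N θ) i / N θ i) * (2 * N θ i * N' i) := by
  rw [dotProduct, Finset.mul_sum]
  refine Finset.sum_congr rfl fun i _ => ?_
  have hi := hpos i
  field_simp

end Identities

end Summit.HubbardSuperconductivity.HubbardSuperconductivity.Theorems.AnisotropyChord.PerronBranch

end
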